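import Literature.Probability.RandomGraphs.PlantedCliqueLowDegree
import Mathlib.Analysis.SpecialFunctions.Pow.Asymptotics
import Mathlib.Algebra.Order.Field.GeomSum
import Mathlib.Data.Finset.Sym
import Mathlib.Data.Nat.Choose.Sum
import Mathlib.Data.Nat.Choose.Bounds
import HarnessLib

/-!
# Planted clique: proof of Hopkins' low-degree bound (`hopkins_lowDegree_bounded_holds`)

Discharge (D-0014) of the named fact `hopkins_lowDegree_bounded` of `PlantedCliqueLowDegree.lean`
— S. B. Hopkins, *Statistical inference and the sum of squares method*, PhD thesis (Cornell
2018), Lemma 2.4.1 — following the printed proof: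

1. **Fourier coefficients of `μ_k`** (proof of Lemma 2.4.1, first display): for a set `T` of edges
   of `K_n` with vertex set `V(T)`, `E_{μ_k} χ_T = (-1)^{|T|} q^{|V(T)|}` with `q = k/n` the
   vertex-inclusion probability (`charMean_plantedBernoulliDist`): given the planted set `S` the
   `G(n,1/2)`-average of `χ_T(plant S x)` vanishes unless every edge of `T` lies inside `S`
   (`sum_erdosRenyiHalf_walsh_plant`), and `P[V(T) ⊆ S] = q^{|V(T)|}` for the product-Bernoulli `S`
   (`sum_bernoulliSubset_indicator`); the sign (our convention `sgn true = -1`) squares away.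
2. Hence `‖L^{≤D}‖² = Σ_{|T| ≤ D} q^{2|V(T)|}` (`lowDegreeLRSq_plantedBernoulliDist`), and grouping
   by the vertex set `W = V(T)` (`|W| = t ≤ 2|T| ≤ 2D`, `T ⊆ E(W)`, `|E(W)| ≤ t²`):
   `‖L^{≤D}‖² ≤ Σ_t C(n,t) cnt(t,D) q^{2t}` with `cnt(t,D) = min(2^{t²}, (t²+1)^D)` for `t ≤ 2D`
   and `0` beyond (`lowDegreeLRSq_plantedBernoulliDist_le`).
3. **Asymptotics** (Hopkins: every term is `n^{-Ω(εt)}`). With `k ≤ n^{1/2-ε}`,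
   `C(n,t) q^{2t} ≤ (k²/n)^t ≤ n^{-2εt}`, while `cnt(t,D) ≤ n^{εt}` for all `t` once `n` is large:
   `2^{t²} = (2^t)^t ≤ n^{εt}` while `2^t ≤ n^ε`, and past that point `D = ⌊C log n⌋ ≤ Kt` for the
   constant `K = ⌈C log 2/ε⌉`, so `(t²+1)^D ≤ ((4D²+1)^K)^t ≤ n^{εt}`, `(4D²+1)^K` being
   polylogarithmic (`cnt_le_pow`, `eventually_polylog_le_rpow`). So
   `‖L^{≤D}‖² ≤ Σ_t n^{-εt} ≤ 1/(1 - n^{-ε}) ≤ 2` eventually (`hopkins_lowDegree_bounded_holds`).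

No new named facts are introduced (D-0026): every intermediate result is proved here.

## References

* S. B. Hopkins, *Statistical inference and the sum of squares method*, PhD thesis, Cornell
  University, 2018, §2.4, Lemma 2.4.1 and its proof [Hopkins2018].
-/

noncomputable section

namespace Literature.Probability.RandomGraphs.PlantedClique

open LowDegree Filter Finset Asymptotics

/-! ### Finite expectations under `PMF.bind` / `PMF.map`; sums over the hypercube -/

/-- `E_{μ.bind g}[f] = Σ_a μ(a) · E_{g a}[f]` on finite types. [folklore] -/
theorem sum_toReal_bind_mul {α β : Type*} [Fintype α] [Fintype β] (μ : PMF α) (g : α → PMF β)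
    (f : β → ℝ) :
    ∑ b, (μ.bind g b).toReal * f b = ∑ a, (μ a).toReal * ∑ b, (g a b).toReal * f b := by
  have h : ∀ b, (μ.bind g b).toReal = ∑ a, (μ a).toReal * (g a b).toReal := by
    intro b
    rw [PMF.bind_apply, tsum_fintype, ENNReal.toReal_sum]
    · exact sum_congr rfl fun a _ => ENNReal.toReal_mul
    · exact fun a _ => ENNReal.mul_ne_top (PMF.apply_ne_top μ a) (PMF.apply_ne_top (g a) b)
  simp_rw [h, sum_mul, mul_sum]
  rw [sum_comm]
  exact sum_congr rfl fun a _ => sum_congr rfl fun b _ => by ring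

/-- `E_{ν.map h}[f] = E_ν[f ∘ h]` on finite types. [folklore] -/
theorem sum_toReal_map_mul {α β : Type*} [Fintype α] [Fintype β] (ν : PMF α) (h : α → β)
    (f : β → ℝ) : ∑ b, (ν.map h b).toReal * f b = ∑ a, (ν a).toReal * f (h a) := by
  rw [← PMF.bind_pure_comp, sum_toReal_bind_mul]
  refine sum_congr rfl fun a _ => ?_
  rw [sum_eq_single (h a) (fun b _ hb => by simp [hb]) fun hh => absurd (mem_univ _) hh]
  simp

/-- `Σ_{y ∈ {0,1}^ι} ∏_i G i (y i) = ∏_i (G i true + G i false)`. [folklore] -/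
theorem sum_prod_bool_eq {ι : Type*} [Fintype ι] [DecidableEq ι] (G : ι → Bool → ℝ) :
    ∑ y : ι → Bool, ∏ i, G i (y i) = ∏ i, (G i true + G i false) := by
  have h : ∑ y : ι → Bool, ∏ i, G i (y i) = ∏ i, ∑ b : Bool, G i b := by
    rw [prod_univ_sum, Fintype.piFinset_univ]
  exact h.trans (prod_congr rfl fun i _ => Fintype.sum_bool _)

/-- `Σ_{y ∈ {0,1}^ι} ∏_{i ∈ T} g i (y i) = 2^{|ι|} ∏_{i ∈ T} (g i true + g i false) / 2`.
[folklore] -/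
theorem sum_prod_bool_finset {ι : Type*} [Fintype ι] [DecidableEq ι] (T : Finset ι)
    (g : ι → Bool → ℝ) : ∑ y : ι → Bool, ∏ i ∈ T, g i (y i) =
      2 ^ Fintype.card ι * ∏ i ∈ T, (g i true + g i false) / 2 := by
  have h1 : ∀ y : ι → Bool, ∏ i ∈ T, g i (y i) =
      ∏ i, (fun i b => if i ∈ T then g i b else (1 : ℝ)) i (y i) := by
    intro y
    rw [prod_ite_mem, univ_inter]
  have h2 : ∀ i, ((if i ∈ T then g i true else 1) + if i ∈ T then g i false else (1 : ℝ)) =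
      2 * if i ∈ T then (g i true + g i false) / 2 else 1 := by
    intro i
    split_ifs <;> ring
  rw [sum_congr rfl fun y _ => h1 y, sum_prod_bool_eq fun i b => if i ∈ T then g i b else (1 : ℝ)]
  simp_rw [h2, prod_mul_distrib, prod_const, card_univ, prod_ite_mem, univ_inter]

/-! ### Vertex sets of edge sets of `K_n` -/

variable {n : ℕ}

/-- `V⟦T⟧`, the vertex set `V(T)` of a set `T` of edges of `K_n`: all endpoints of its edges
(`Sym2.toFinset`). Local notation only. [Hopkins 2018, §2.4 (`V(α)`)] -/
local notation3 "V⟦" T "⟧" => Finset.biUnion T fun e => Sym2.toFinset (Subtype.val e)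

/-- An edge has at most two endpoints. [folklore] -/
theorem card_toFinset_le_two {α : Type*} [DecidableEq α] (z : Sym2 α) : z.toFinset.card ≤ 2 := by
  rw [Sym2.card_toFinset]
  split_ifs <;> norm_num

/-- `|V(T)| ≤ 2|T|`. [folklore] -/
theorem card_verts_le (T : Finset (⊤ : SimpleGraph (Fin n)).edgeSet) : (V⟦T⟧).card ≤ 2 * T.card :=
  calc (V⟦T⟧).card ≤ ∑ e ∈ T, (e : Sym2 (Fin n)).toFinset.card := card_biUnion_le
    _ ≤ ∑ _e ∈ T, 2 := sum_le_sum fun e _ => card_toFinset_le_two _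
    _ = 2 * T.card := by rw [sum_const, smul_eq_mul, mul_comm]

/-- `V(T) ⊆ S` iff every edge of `T` has both endpoints in `S`. [folklore] -/
theorem verts_subset_iff {T : Finset (⊤ : SimpleGraph (Fin n)).edgeSet} {S : Finset (Fin n)} :
    V⟦T⟧ ⊆ S ↔ ∀ e ∈ T, ∀ v ∈ (e : Sym2 (Fin n)), v ∈ S := by
  rw [biUnion_subset]
  simp only [subset_iff, Sym2.mem_toFinset]

/-- `|E(W)| ≤ |W|²` for the set `E(W)` of edges of `K_n` inside `W` (crudely; the exact count is
`C(|W|, 2)`). [folklore] -/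
theorem card_edgesIn_le (W : Finset (Fin n)) :
    (univ.filter fun e : (⊤ : SimpleGraph (Fin n)).edgeSet => (e : Sym2 (Fin n)).toFinset ⊆ W).card
      ≤ W.card ^ 2 :=
  calc _ ≤ W.sym2.card := by
        refine card_le_card_of_injOn (fun e => (e : Sym2 (Fin n))) (fun e he => ?_)
          fun e₁ _ e₂ _ h => Subtype.ext h
        have he' : (e : Sym2 (Fin n)).toFinset ⊆ W := by simpa using he
        exact mem_coe.2 (Finset.mem_sym2_iff.2 fun v hv => he' (Sym2.mem_toFinset.2 hv))
    _ = (W.card + 1).choose 2 := card_sym2 W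
    _ ≤ W.card ^ 2 := by
        rw [Nat.choose_two_right, Nat.add_sub_cancel]
        exact Nat.div_le_of_le_mul (by nlinarith [W.card.le_mul_self])

/-! ### Fourier coefficients of the Bernoulli planted-clique distribution -/

/-- Given the planted set `S`, `Σ_x χ_T(plant S x) = 2^N · (-1)^{|T|} · [V(T) ⊆ S]` over all edge
vectors `x` (the sum vanishes as soon as one edge of `T` is not forced). [Hopkins 2018, proof of
Lemma 2.4.1] [folklore] -/
theorem sum_walsh_plant (S : Finset (Fin n)) (T : Finset (⊤ : SimpleGraph (Fin n)).edgeSet) :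
    ∑ y : EdgeVec n, walsh T (plant S y) = 2 ^ Fintype.card (⊤ : SimpleGraph (Fin n)).edgeSet *
      ((-1) ^ T.card * if V⟦T⟧ ⊆ S then 1 else 0) := by
  -- `c e = [both endpoints of e lie in S]` (forced-edge indicator); `plant S y e = y e ∨ c e`
  set c : (⊤ : SimpleGraph (Fin n)).edgeSet → Bool := plant S fun _ => false with hc
  have hce : ∀ e, c e = true ↔ ∀ v ∈ (e : Sym2 (Fin n)), v ∈ S := fun e => by simp [hc, plant]
  set g : (⊤ : SimpleGraph (Fin n)).edgeSet → Bool → ℝ := fun e b => sgn (b || c e) with hg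
  have hw : ∀ y : EdgeVec n, walsh T (plant S y) = ∏ e ∈ T, g e (y e) := fun y =>
    prod_congr rfl fun e _ => by simp [hg, hc, plant]
  have h3 : ∀ e, (g e true + g e false) / 2 = (-1 : ℝ) * if c e = true then 1 else 0 := by
    intro e
    simp only [hg, Bool.true_or, Bool.false_or, sgn_true]
    cases c e <;> simp [sgn]
  rw [sum_congr rfl fun y _ => hw y, sum_prod_bool_finset T g, prod_congr rfl fun e _ => h3 e,
    prod_mul_distrib, prod_const, prod_boole]
  congr 2
  by_cases hTS : V⟦T⟧ ⊆ S
  · rw [if_pos hTS, if_pos fun e he => (hce e).2 (verts_subset_iff.1 hTS e he)]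
  · rw [if_neg hTS, if_neg fun h => hTS (verts_subset_iff.2 fun e he => (hce e).1 (h e he))]

/-- Conditionally on `S`, the `G(n,1/2)`-expectation of `χ_T(plant S x)` is
`(-1)^{|T|} [V(T) ⊆ S]`. [Hopkins 2018, proof of Lemma 2.4.1] [folklore] -/
theorem sum_erdosRenyiHalf_walsh_plant (S : Finset (Fin n))
    (T : Finset (⊤ : SimpleGraph (Fin n)).edgeSet) :
    ∑ y, (erdosRenyiHalf n y).toReal * walsh T (plant S y) =
      (-1) ^ T.card * if V⟦T⟧ ⊆ S then 1 else 0 := by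
  have hu : ∀ y : EdgeVec n, (erdosRenyiHalf n y).toReal =
      ((2 : ℝ) ^ Fintype.card (⊤ : SimpleGraph (Fin n)).edgeSet)⁻¹ := by
    intro y
    rw [erdosRenyiHalf, PMF.uniformOfFintype_apply, ENNReal.toReal_inv, ENNReal.toReal_natCast,
      Fintype.card_fun, Fintype.card_bool]
    push_cast
    ring
  simp_rw [hu]
  rw [← mul_sum, sum_walsh_plant, inv_mul_cancel_left₀ (by positivity)]

/-- `P[W ⊆ S] = q^{|W|}` for the product-Bernoulli vertex set `S`, `q = min (k/n) 1`.
[Hopkins 2018, proof of Lemma 2.4.1 ("with probability precisely `(k/n)^{|V(α)|}`")] [folklore] -/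
theorem sum_bernoulliSubset_indicator (n k : ℕ) (W : Finset (Fin n)) :
    ∑ S, (bernoulliSubset n k S).toReal * (if W ⊆ S then (1 : ℝ) else 0) =
      (inclProb n k).toReal ^ W.card := by
  set q := inclProb n k with hq
  have hq1 : q ≤ 1 := inclProb_le_one n k
  have hsub : (1 - q).toReal = 1 - q.toReal := by
    rw [ENNReal.toReal_sub_of_le hq1 ENNReal.one_ne_top, ENNReal.toReal_one]
  set G : Fin n → Bool → ℝ := fun i b =>
    (bernWeight q b).toReal * if i ∈ W then (if b = true then 1 else 0) else 1 with hG
  have hind : ∀ s : Fin n → Bool, (if W ⊆ univ.filter (fun i => s i) then (1 : ℝ) else 0) =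
      ∏ i, if i ∈ W then (if s i = true then 1 else 0) else 1 := by
    intro s
    rw [prod_ite_mem, univ_inter, prod_boole]
    by_cases h : ∀ i ∈ W, s i = true
    · have h' : W ⊆ univ.filter fun i => s i := fun i hi => by simpa using h i hi
      rw [if_pos h, if_pos h']
    · have h' : ¬W ⊆ univ.filter fun i => s i := fun h' => h fun i hi => by simpa using h' hi
      rw [if_neg h, if_neg h']
  have hterm : ∀ s : Fin n → Bool, (bernoulliVec n q hq1 s).toReal *
      (if W ⊆ univ.filter (fun i => s i) then (1 : ℝ) else 0) = ∏ i, G i (s i) := by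
    intro s
    rw [bernoulliVec_apply, ENNReal.toReal_prod, hind, ← prod_mul_distrib]
  have hGi : ∀ i, G i true + G i false = if i ∈ W then q.toReal else 1 := by
    intro i
    simp only [hG, bernWeight, if_true, Bool.false_eq_true, if_false, hsub]
    split_ifs <;> ring
  rw [bernoulliSubset, sum_toReal_map_mul, sum_congr rfl fun s _ => hterm s, sum_prod_bool_eq,
    prod_congr rfl fun i _ => hGi i, prod_ite_mem, univ_inter, prod_const]

/-- **Fourier coefficients of `μ_k`.** `E_{μ_k} χ_T = (-1)^{|T|} q^{|V(T)|}`, `q = min (k/n) 1`.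
[Hopkins 2018, proof of Lemma 2.4.1, first display] [folklore] -/
theorem charMean_plantedBernoulliDist (n k : ℕ) (T : Finset (⊤ : SimpleGraph (Fin n)).edgeSet) :
    charMean (plantedBernoulliDist n k) T =
      (-1) ^ T.card * (inclProb n k).toReal ^ (V⟦T⟧).card := by
  rw [charMean, plantedBernoulliDist, sum_toReal_bind_mul]
  simp_rw [sum_toReal_map_mul, sum_erdosRenyiHalf_walsh_plant, mul_left_comm _ ((-1 : ℝ) ^ T.card),
    ← mul_sum, sum_bernoulliSubset_indicator]

/-- `‖L^{≤D}‖²(μ_k) = Σ_{|T| ≤ D} q^{2|V(T)|}`. [Hopkins 2018, proof of Lemma 2.4.1] [folklore] -/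
theorem lowDegreeLRSq_plantedBernoulliDist (n k D : ℕ) :
    lowDegreeLRSq (plantedBernoulliDist n k) D = ∑ T ∈ degLE ((⊤ : SimpleGraph (Fin n)).edgeSet) D,
      ((inclProb n k).toReal ^ 2) ^ (V⟦T⟧).card := by
  refine sum_congr rfl fun T _ => ?_
  rw [charMean_plantedBernoulliDist, mul_pow, ← pow_mul, ← pow_mul, mul_comm T.card 2, pow_mul,
    neg_one_sq, one_pow, one_mul, mul_comm _ 2, pow_mul]

/-! ### Counting edge sets by their vertex set -/

/-- `cnt⟦t, D⟧`, a bound for the number of edge sets `T` with `|T| ≤ D` and a given `t`-element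
vertex set: `0` if `t > 2D`, else `min (2^{t²}) ((t²+1)^D)`. Local notation only. [folklore] -/
local notation3 "cnt⟦" t ", " D "⟧" =>
  (if 2 * D < t then 0 else min (2 ^ (t ^ 2)) ((t ^ 2 + 1) ^ D) : ℕ)

/-- `Σ_{m ≤ D} N^m ≤ (N+1)^D`. [folklore] -/
theorem sum_range_pow_le (N D : ℕ) : ∑ m ∈ range (D + 1), N ^ m ≤ (N + 1) ^ D := by
  induction D with
  | zero => simp
  | succ D ih =>
    rw [sum_range_succ]
    calc ∑ m ∈ range (D + 1), N ^ m + N ^ (D + 1) ≤ (N + 1) ^ D + N * (N + 1) ^ D :=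
          Nat.add_le_add ih (by
            rw [pow_succ']
            exact Nat.mul_le_mul_left _ (Nat.pow_le_pow_left N.le_succ _))
      _ = (N + 1) ^ (D + 1) := by ring

/-- `#{T ⊆ E : |T| ≤ D} ≤ (|E|+1)^D`. [folklore] -/
theorem card_powerset_filter_card_le {α : Type*} [DecidableEq α] (E : Finset α) (D : ℕ) :
    (E.powerset.filter fun T => T.card ≤ D).card ≤ (E.card + 1) ^ D :=
  calc (E.powerset.filter fun T => T.card ≤ D).card
      ≤ ((range (D + 1)).biUnion fun m => E.powersetCard m).card := by
        refine card_le_card fun T hT => ?_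
        rw [mem_filter, mem_powerset] at hT
        exact mem_biUnion.2 ⟨T.card, mem_range.2 (Nat.lt_succ_of_le hT.2),
          mem_powersetCard.2 ⟨hT.1, rfl⟩⟩
    _ ≤ ∑ m ∈ range (D + 1), (E.powersetCard m).card := card_biUnion_le
    _ ≤ ∑ m ∈ range (D + 1), E.card ^ m :=
        sum_le_sum fun m _ => (card_powersetCard _ _).trans_le (Nat.choose_le_pow _ _)
    _ ≤ (E.card + 1) ^ D := sum_range_pow_le _ _

/-- The edge sets `T` with `|T| ≤ D` and `V(T) = W` are subsets of size `≤ D` of the set `E(W)` of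
edges inside `W`. [folklore] -/
theorem fiber_subset (D : ℕ) (W : Finset (Fin n)) :
    ((degLE ((⊤ : SimpleGraph (Fin n)).edgeSet) D).filter fun T => V⟦T⟧ = W) ⊆
      (univ.filter fun e : (⊤ : SimpleGraph (Fin n)).edgeSet =>
        (e : Sym2 (Fin n)).toFinset ⊆ W).powerset.filter fun T => T.card ≤ D := by
  intro T hT
  simp only [degLE, mem_filter, mem_univ, true_and] at hT
  rw [mem_filter, mem_powerset]
  refine ⟨fun e he => ?_, hT.1⟩
  simp only [mem_filter, mem_univ, true_and]
  rw [← hT.2]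
  exact subset_biUnion_of_mem (fun e : (⊤ : SimpleGraph (Fin n)).edgeSet =>
    (e : Sym2 (Fin n)).toFinset) he

/-- **Fiber count**: at most `cnt⟦|W|, D⟧` edge sets `T` with `|T| ≤ D` have `V(T) = W`.
[Hopkins 2018, proof of Lemma 2.4.1 (counting `α` by `|V(α)|`)] [folklore] -/
theorem card_fiber_le (D : ℕ) (W : Finset (Fin n)) :
    ((degLE ((⊤ : SimpleGraph (Fin n)).edgeSet) D).filter fun T => V⟦T⟧ = W).card ≤
      cnt⟦W.card, D⟧ := by
  split_ifs with h
  · rw [Nat.le_zero, card_eq_zero, filter_eq_empty_iff]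
    intro T hT hTW
    simp only [degLE, mem_filter, mem_univ, true_and] at hT
    have := card_verts_le T
    rw [hTW] at this
    omega
  · have h1 := card_le_card (fiber_subset D W)
    refine le_min (h1.trans ((card_filter_le _ _).trans ?_))
      (h1.trans ((card_powerset_filter_card_le _ _).trans
        (Nat.pow_le_pow_left (Nat.succ_le_succ (card_edgesIn_le W)) _)))
    rw [card_powerset]
    exact Nat.pow_le_pow_right (by norm_num) (card_edgesIn_le W)

/-- **Grouping by the vertex set**: `‖L^{≤D}‖²(μ_k) ≤ Σ_{t ≤ n} C(n,t) · cnt(t,D) · q^{2t}`.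
[Hopkins 2018, proof of Lemma 2.4.1] [folklore] -/
theorem lowDegreeLRSq_plantedBernoulliDist_le (n k D : ℕ) :
    lowDegreeLRSq (plantedBernoulliDist n k) D ≤ ∑ t ∈ range (n + 1), (n.choose t : ℝ) *
      ((cnt⟦t, D⟧ : ℝ) * ((inclProb n k).toReal ^ 2) ^ t) := by
  set x : ℝ := (inclProb n k).toReal ^ 2
  have h := sum_powerset_apply_card (fun t => (cnt⟦t, D⟧ : ℝ) * x ^ t)
    (x := (univ : Finset (Fin n)))
  simp only [powerset_univ, card_univ, Fintype.card_fin, nsmul_eq_mul] at h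
  rw [lowDegreeLRSq_plantedBernoulliDist, ← h, ← sum_fiberwise (degLE _ D)
    (fun T : Finset (⊤ : SimpleGraph (Fin n)).edgeSet => V⟦T⟧) fun T => x ^ (V⟦T⟧).card]
  refine sum_le_sum fun W _ => ?_
  rw [sum_congr rfl fun T hT => by rw [(mem_filter.1 hT).2], sum_const, nsmul_eq_mul]
  gcongr
  exact_mod_cast card_fiber_le D W

/-! ### Asymptotics -/

/-- Pointwise domination `cnt(t,D) ≤ z^t` in the two regimes `2^t ≤ z` (use `2^{t²} = (2^t)^t`)
and `2^t > z` (then `D ≤ K t`, use `(t²+1)^D ≤ ((4D²+1)^K)^t`). [folklore] -/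
theorem cnt_le_pow (t D K : ℕ) (z : ℝ) (hz1 : 1 ≤ z)
    (hK : ∀ t : ℕ, z < 2 ^ t → D ≤ K * t) (hpoly : (4 * (D : ℝ) ^ 2 + 1) ^ K ≤ z) :
    (cnt⟦t, D⟧ : ℝ) ≤ z ^ t := by
  split_ifs with h
  · simp only [Nat.cast_zero]
    positivity
  · push Not at h
    rcases le_or_gt ((2 : ℝ) ^ t) z with h2 | h2
    · calc ((min (2 ^ (t ^ 2)) ((t ^ 2 + 1) ^ D) : ℕ) : ℝ) ≤ ((2 ^ (t ^ 2) : ℕ) : ℝ) := by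
            exact_mod_cast min_le_left _ _
        _ = ((2 : ℝ) ^ t) ^ t := by push_cast; rw [sq, pow_mul]
        _ ≤ z ^ t := pow_le_pow_left₀ (by positivity) h2 t
    · have ht : (t : ℝ) ^ 2 ≤ 4 * (D : ℝ) ^ 2 := by
        have : (t : ℝ) ≤ 2 * D := by exact_mod_cast h
        nlinarith
      calc ((min (2 ^ (t ^ 2)) ((t ^ 2 + 1) ^ D) : ℕ) : ℝ) ≤ (((t ^ 2 + 1) ^ (K * t) : ℕ) : ℝ) := by
            exact_mod_cast
              (min_le_right _ _).trans (Nat.pow_le_pow_right (Nat.succ_pos _) (hK t h2))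
        _ = (((t : ℝ) ^ 2 + 1) ^ K) ^ t := by push_cast; rw [pow_mul]
        _ ≤ ((4 * (D : ℝ) ^ 2 + 1) ^ K) ^ t := by gcongr
        _ ≤ z ^ t := pow_le_pow_left₀ (by positivity) hpoly t

/-- Polylog versus power: `(4C² log² x + 1)^K ≤ x^ε` for all large real `x`. [folklore] -/
theorem eventually_polylog_le_rpow (C : ℝ) {ε : ℝ} (hε : 0 < ε) (K : ℕ) :
    ∀ᶠ x : ℝ in atTop, (4 * C ^ 2 * Real.log x ^ 2 + 1) ^ K ≤ x ^ ε := by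
  have hlo : (fun x => Real.log x ^ (2 * K)) =o[atTop] fun x => x ^ ε :=
    (isLittleO_log_rpow_rpow_atTop ((2 * K : ℕ) : ℝ) hε).congr_left fun x => Real.rpow_natCast _ _
  have hc : (0 : ℝ) < ((4 * C ^ 2 + 1) ^ K)⁻¹ := by positivity
  filter_upwards [hlo.def hc, Real.tendsto_log_atTop.eventually_ge_atTop 1,
    eventually_ge_atTop (0 : ℝ)] with x hx hL hx0
  have hL2 : (1 : ℝ) ≤ Real.log x ^ 2 := one_le_pow₀ hL
  rw [Real.norm_of_nonneg (pow_nonneg (zero_le_one.trans hL) _),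
    Real.norm_of_nonneg (Real.rpow_nonneg hx0 _)] at hx
  calc (4 * C ^ 2 * Real.log x ^ 2 + 1) ^ K ≤ ((4 * C ^ 2 + 1) * Real.log x ^ 2) ^ K := by
        gcongr
        nlinarith [sq_nonneg C]
    _ = (4 * C ^ 2 + 1) ^ K * Real.log x ^ (2 * K) := by rw [mul_pow, pow_mul]
    _ ≤ (4 * C ^ 2 + 1) ^ K * (((4 * C ^ 2 + 1) ^ K)⁻¹ * x ^ ε) := by gcongr
    _ = x ^ ε := by field_simp

/-- The deterministic core of the final estimate: if `n ≥ 1`, `z = n^ε ≥ 2`, `k ≤ n^{1/2-ε}`,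
`D ≤ K t` whenever `2^t > z`, and `(4D²+1)^K ≤ z`, then `Σ_t C(n,t) cnt(t,D) q^{2t} ≤ 2`
(`q = min (k/n) 1`): termwise `C(n,t) q^{2t} ≤ (k²/n)^t ≤ z^{-2t}` and `cnt(t,D) ≤ z^t`, then a
geometric sum of ratio `z⁻¹ ≤ 1/2`. [folklore] -/
theorem sum_choose_cnt_le_two (n k D K : ℕ) (ε z : ℝ) (hn : 1 ≤ n) (hz : z = (n : ℝ) ^ ε)
    (hz2 : 2 ≤ z) (hk : (k : ℝ) ≤ (n : ℝ) ^ (1 / 2 - ε)) (hK : ∀ t : ℕ, z < 2 ^ t → D ≤ K * t)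
    (hpoly : (4 * (D : ℝ) ^ 2 + 1) ^ K ≤ z) :
    ∑ t ∈ range (n + 1), (n.choose t : ℝ) *
      ((cnt⟦t, D⟧ : ℝ) * ((inclProb n k).toReal ^ 2) ^ t) ≤ 2 := by
  have hn0 : (0 : ℝ) < n := by exact_mod_cast hn
  have hz0 : 0 < z := by linarith
  set p : ℝ := (inclProb n k).toReal with hp
  set y : ℝ := z⁻¹ with hy
  have hy0 : 0 ≤ y := by positivity
  have hy2 : y ≤ 2⁻¹ := inv_anti₀ two_pos hz2
  have hpk : p ≤ k / n := by
    have h1 : ((k : ENNReal) / n).toReal = (k : ℝ) / n := by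
      rw [ENNReal.toReal_div, ENNReal.toReal_natCast, ENNReal.toReal_natCast]
    rw [hp, inclProb, ← h1]
    exact ENNReal.toReal_mono (ENNReal.div_ne_top (ENNReal.natCast_ne_top k)
      (Nat.cast_ne_zero.2 (by omega))) (min_le_left _ _)
  have hk2 : (k : ℝ) ^ 2 ≤ n / z ^ 2 := by
    have h2 : ((n : ℝ) ^ (1 / 2 : ℝ)) ^ 2 = n := by
      rw [← Real.rpow_mul_natCast hn0.le]
      norm_num
    calc (k : ℝ) ^ 2 ≤ ((n : ℝ) ^ (1 / 2 - ε)) ^ 2 := pow_le_pow_left₀ (Nat.cast_nonneg _) hk 2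
      _ = n / z ^ 2 := by rw [hz, Real.rpow_sub hn0, div_pow, h2]
  have hnx : (n : ℝ) * p ^ 2 ≤ y ^ 2 :=
    calc (n : ℝ) * p ^ 2 ≤ n * ((k : ℝ) / n) ^ 2 := by gcongr
      _ = (k : ℝ) ^ 2 / n := by field_simp
      _ ≤ n / z ^ 2 / n := by gcongr
      _ = y ^ 2 := by rw [hy, inv_pow]; field_simp
  have hterm : ∀ t ∈ range (n + 1),
      (n.choose t : ℝ) * ((cnt⟦t, D⟧ : ℝ) * (p ^ 2) ^ t) ≤ y ^ t := by
    intro t _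
    have hc : (cnt⟦t, D⟧ : ℝ) ≤ z ^ t := cnt_le_pow t D K z (by linarith) hK hpoly
    calc (n.choose t : ℝ) * ((cnt⟦t, D⟧ : ℝ) * (p ^ 2) ^ t)
        ≤ (n : ℝ) ^ t * ((cnt⟦t, D⟧ : ℝ) * (p ^ 2) ^ t) := by
          gcongr
          exact_mod_cast Nat.choose_le_pow n t
      _ = (cnt⟦t, D⟧ : ℝ) * ((n : ℝ) * p ^ 2) ^ t := by rw [mul_pow]; ring
      _ ≤ z ^ t * (y ^ 2) ^ t :=
          mul_le_mul hc (pow_le_pow_left₀ (by positivity) hnx t) (by positivity) (by positivity)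
      _ = (y * z) ^ t * y ^ t := by ring
      _ = y ^ t := by rw [hy, inv_mul_cancel₀ hz0.ne', one_pow, one_mul]
  calc ∑ t ∈ range (n + 1), (n.choose t : ℝ) * ((cnt⟦t, D⟧ : ℝ) * (p ^ 2) ^ t)
      ≤ ∑ t ∈ range (n + 1), y ^ t := sum_le_sum hterm
    _ ≤ y ^ 0 / (1 - y) := by
        rw [range_eq_Ico]
        exact geom_sum_Ico_le_of_lt_one hy0 (by linarith)
    _ ≤ 2 := by
        rw [pow_zero, div_le_iff₀ (by linarith)]
        linarith

/-- **Hopkins (2018), Lemma 2.4.1** — discharge of `hopkins_lowDegree_bounded`: for every `ε > 0`,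
`C > 0` and `k(n) ≤ n^{1/2-ε}` eventually, the squared `⌊C log n⌋`-low-degree likelihood ratio
of the Bernoulli planted-clique distribution `μ_{k(n)}` against `G(n,1/2)` is eventually `≤ 2`
(in particular bounded). [cite: Hopkins2018, Lemma 2.4.1] -/
theorem hopkins_lowDegree_bounded_holds : hopkins_lowDegree_bounded := by
  intro ε hε C hC k hk
  obtain ⟨K, hK⟩ := exists_nat_ge (C * Real.log 2 / ε)
  refine ⟨2, ?_⟩
  have hz : Tendsto (fun n : ℕ => (n : ℝ) ^ ε) atTop atTop :=
    (tendsto_rpow_atTop hε).comp tendsto_natCast_atTop_atTop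
  have hpoly : ∀ᶠ n : ℕ in atTop, (4 * C ^ 2 * Real.log n ^ 2 + 1) ^ K ≤ (n : ℝ) ^ ε :=
    tendsto_natCast_atTop_atTop.eventually (eventually_polylog_le_rpow C hε K)
  filter_upwards [hk, hz.eventually_ge_atTop 2, hpoly, eventually_ge_atTop 1] with n hkn hz2 hpn hn
  have hn0 : (0 : ℝ) < n := by exact_mod_cast hn
  have hD : (⌊C * Real.log n⌋₊ : ℝ) ≤ C * Real.log n :=
    Nat.floor_le (mul_nonneg hC.le (Real.log_nonneg (by exact_mod_cast hn)))
  refine (lowDegreeLRSq_plantedBernoulliDist_le n (k n) _).trans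
    (sum_choose_cnt_le_two n (k n) _ K ε _ hn rfl hz2 hkn (fun t ht => ?_) ?_)
  · -- past the regime switch `2^t > n^ε` we have `D = ⌊C log n⌋ ≤ K t`
    have h1 : ε * Real.log n < t * Real.log 2 := by
      rw [← Real.log_rpow hn0, ← Real.log_pow]
      exact Real.log_lt_log (Real.rpow_pos_of_pos hn0 ε) ht
    have h2 : (⌊C * Real.log n⌋₊ : ℝ) < K * t :=
      calc (⌊C * Real.log n⌋₊ : ℝ) ≤ C * Real.log n := hD
        _ < C * (t * Real.log 2 / ε) := by
            gcongr
            rwa [lt_div_iff₀ hε, mul_comm]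
        _ = C * Real.log 2 / ε * t := by ring
        _ ≤ K * t := by gcongr
    exact_mod_cast h2.le
  · calc (4 * (⌊C * Real.log n⌋₊ : ℝ) ^ 2 + 1) ^ K ≤ (4 * C ^ 2 * Real.log n ^ 2 + 1) ^ K := by
          gcongr ?_ ^ K
          calc 4 * (⌊C * Real.log n⌋₊ : ℝ) ^ 2 + 1 ≤ 4 * (C * Real.log n) ^ 2 + 1 := by gcongr
            _ = 4 * C ^ 2 * Real.log n ^ 2 + 1 := by ring
      _ ≤ (n : ℝ) ^ ε := hpn

end Literature.Probability.RandomGraphs.PlantedClique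

end
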